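import Literature.NumberTheory.LFunctions.Zhang2022.KnifeEdgeNuOverhang
import Literature.NumberTheory.LFunctions.Zhang2022.Section4Eq48Deduction
import Literature.NumberTheory.LFunctions.Zhang2022.Section4WeightedAbel

/-!
# Zhang (2022), rung F-S3 (Landau–Siegel programme, family B-len): the νψ-overhang of a LIPSCHITZ profile is
# invisible on `Ψ₁` — registry row E-074′ «ν-piece invisible-(A)» as a KERNEL THEOREM (pointwise on `Ψ₁`,
# unconditionally; in the relative discrete-mean currency of E-003; and in the absolute currency modulo a
# displayed weight-mass binder), closing the gap `NuPieceInvisible → NuMeanInvisible` left open in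
# `KnifeEdgeNuOverhang` (p461177) for the Lipschitz sub-class

Y. Zhang, *Discrete mean estimates and the Landau–Siegel zero*, arXiv:2211.02515v1 [Zhang2022LandauSiegel] —
an unrefereed manuscript under adjudication. **WHAT THIS IS NOT: not a claim about Theorems 1–2 of
arXiv:2211.02515, about Landau–Siegel zeros, or about Parity. The programme SEARCHES and TYPES. Every theorem
below is either unconditional finite-sum / real analysis over the typed skeleton (`SkeletonObjects`: `Ψ₁` is
FORMALLY DEFINED by (3.4)–(3.6), so statements «for `ψ ∈ Ψ₁`» assert nothing about any character), or an
implication whose analytic hypotheses are the named nodes `Prop22i`, `Lemma23` of `SkeletonPropositions` and a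
displayed weight-mass binder. No new `Prop` is introduced except the profile-class predicate `lipOverhang`
(a definition with an inhabitant, `lipOverhang_lipTent`).**

**The gap this file closes (cell `landau-siegel`, B-len/EDLIST.md v1.2 row E-074′, `obj/EDREGISTRY.md` E-074).**
`KnifeEdgeNuOverhang` (p461177) typed ls-theory's ruling «a `ν = 1∗χ` overhang piece is invisible at main order»
as two bare `Prop`s — the pointwise `NuPieceInvisible θ c` (with a FREE exceptional set of characters) and the
discrete-mean `NuMeanInvisible c′ θ 𝒱 S` — proved the kernel consequences of the latter (`not_nuCloses_of_invisible`,
`mainTerm_add_nuPiece`), and recorded «NOT here: the derivation `NuPieceInvisible → NuMeanInvisible`». That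
derivation does NOT go through as bookkeeping: for a member of `Ψ₁` inside a free exceptional set only the trivial
bound (`≍ P^{θ/2}`) is available, and the manuscript disposes of exceptional characters by the contour/Hölder
device (7.3), not by counting. What DOES go through — and needs neither (A) nor any exceptional set — is the
manuscript's own §4 mechanism ON `Ψ₁` ITSELF, the index set of every discrete mean: (3.5) is part of the
DEFINITION of `Ψ₁`, and (3.5) is exactly what the (4.8) partial-summation device consumes.

**PROVED (Parts 1–5, unconditional).**
* Part 1 — the partial-summation device with a DISCRETE weight (the Lipschitz twin of the tree's `C¹` device
  `Section4.norm_sum_mul_weight_le`): `sum_Ioc_mul_eq_sub_sum_Ico` (Abel, exact), `norm_sum_Ioc_mul_le_sum_Ico`,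
  `norm_Xsum_div_le_integral` (the step function `X_a` against `dx/x` on a unit cell), and
  `norm_sum_Ioc_mul_le_of_step`: `‖Σ_{⌊a⌋<n≤⌊b⌋} c(n)f(n)‖ ≤ A‖X_a(b)‖ + 2B∫_a^b‖X_a(x)‖x⁻¹dx` whenever
  `‖f(⌊b⌋)‖ ≤ A` and `n‖f(n+1) − f(n)‖ ≤ B` — only the endpoint value and the `dx/x`-average of the partial sums
  enter (the shape of (3.5)).
* Part 2 — the class `lipOverhang θ` (`K`-Lipschitz on `ℝ`, `= 0` off `[1,θ]`; hence wall value `v(1) = 0` and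
  top value `v(θ) = 0`: `LipOverhang.apply_of_le_one` / `apply_of_le`; sup `≤ K(θ−1)`: `LipOverhang.norm_le`),
  its inhabitants `lipOverhang_zero`, `lipOverhang_lipTent`, the inclusion `bvOverhang_of_lipOverhang` into the
  ruling's bounded-variation class (p461177), and the MVT step `norm_natCast_succ_cpow_sub_cpow_le`.
* Part 3 — **`norm_nuPoly_le_of_psiOne`**: for all large `D`, EVERY `χ`, every `1 < θ ≤ 2`, every `x = (p,ψ) ∈ Ψ₁`,
  every sampled zero `ρ ∈ 𝔷(ψ)` with `Re ρ = ½`, every `K`-Lipschitz `v` vanishing off `[1,θ]`: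
  `‖Σ_{n<P^θ} ν(n)ψ(n)v(z_n)n^{−ρ}‖ ≤ 4K·𝓛^{−180}` (`𝓛^{405−585}`: the `𝓛₁` of `|s₀ − ρ|` against the `𝓛^{−585}` of
  (3.5); the manuscript's (4.8) exponent). Mechanism verbatim from §4 p. 9 / (4.8) p. 20: `ν(n)ψ(n)n^{−ρ} =
  c(n)f(n)`, `c(n) = ν(n)ψ(n)n^{−s₀}` whose partial sums from `D⁴` are `X₃(·,ψ)` (`Section4.Xsum_eq_X3`), weight
  `f(n) = v(z_n)n^{s₀−ρ}` with `|n^{s₀−ρ}| = 1`; Abel over the WHOLE range `(D⁴, P²]` (the profile kills `n < P` and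
  `n ≥ P^θ`, `θ ≤ 2`), so only `X₃(P²,ψ)` and `∫_{D⁴}^{P²}|X₃|dx/x` appear.
* Part 4 — **`discMean_nuPoly_le`**: IF `Re ρ = ½` on the index set (Prop. 2.2 (i)'s output, displayed), the
  discrete mean (2.16) of the νψ polynomial is `≤ (4K𝓛^{−180})²·discWeight` — the RELATIVE currency of the tree's
  E-003 theorems (`KnifeEdgeDiscMeanFlat.discMeanFlat`, `Repair.farPiece`: bounds against `discMeanAbs + discWeight`).
* Part 5 — **`abs_discMean_add_nuPoly_sub_le`** (raw binders) / **`abs_discMean_add_nuPoly_sub_le_of_prop22i`**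
  (`Prop22i`, `Lemma23 c′`): for EVERY family of test values `F` — any design of any class — with `δ = 4K𝓛^{−180}`,
  `|Ξ(F + A_ν) − Ξ(F)| ≤ δ·(Ξ(F) + discWeight) + δ²·discWeight`: ls-theory's «TRUE(u ⊕ v_ν) = TRUE(u) + o(main) ⇒
  no lever of either sign» as a kernel theorem for the Lipschitz class — the §E-intake shape of B-len's (L-b)ν «no».

**PROVED (Part 6, absolute currency, kernel implications).** `nuMeanInvisible_lipOverhang_of_weightMass`: a
DISPLAYED weight-mass binder `discWeight ≤ W·𝓛^k·S·𝔓` under (A) with `k < 360` (the polylog mass of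
`ΣΣ Re 𝔠*·Re ω` at the class's scale; ls-theory 17:33:45Z «below main order once `c′` beats the polylog mass of the
weights»; asserted by no one) + `ScaleEventuallyPos S` + `Prop22i` ⇒ `NuMeanInvisible c′ θ (lipOverhang θ) S`;
hence `not_nuCloses_lipOverhang_of_weightMass` (dictionary of record `(M, X) = (0, 0)`, no closing) and
`mainTerm_add_nuPiece_lipOverhang_of_weightMass` by p461177's theorems.

**DECLARED NARROWING — what is NOT covered, and why (honest).** (1) Profiles with a JUMP (wall value `v(1⁺) ≠ 0`,
top value `v(θ⁻) ≠ 0`, interior jumps; e.g. the 12 `len-nu-rampcut-*` designs of B-len BATCH-1 with `v(T⁻) = 1`):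
the device then needs the partial sum `X₃(y,ψ)` POINTWISE at the jump abscissae `y = P^T`, which (3.4)–(3.6) do not
provide (only `X₃(P²,ψ)` and the `dx/x`-average) — so the jump class is NOT decided by `Ψ₁` as defined; the other 36
ν designs of BATCH-1 (`bump`/`front`/`back`: polynomial on `[1, top]`, zero at both ends, no jumps) are in
`lipOverhang`. (2) `θ ≤ 2` (the range `n ≤ P²` of (3.5); EDLIST's `θ ∈ (1, 5/4]` and narrowing n-len-3's `(5/4, 2)`
are inside). (3) The absolute currency needs the weight-mass input (Part 6 binder); the relative currency (Parts
4–5) needs only `Re ρ = ½` on the index set. (4) Nothing here evaluates `discWeight`, proves `NuPieceInvisible`, or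
touches rows E-070/E-071 (Λ), E-072/E-073 (μψ), E-075 (moot).

References: Zhang, arXiv:2211.02515v1, §2 (2.14)–(2.16), Lemma 2.3, Prop. 2.2, p. 4 («Proposition 2.2 and some
other results for `ψ ∈ Ψ₁` are unconditionally derived from the definition of `Ψ₁`»); §3 (3.5), p. 7 (definition
of `Ψ₁`, `X₃`); §4 Lemma 4.2 (proof), p. 9 and (4.8) p. 20 (the partial-integration display
`Σ_{D⁴<n≤P²} ν(n)ψ(n)n^{−(s*+iv)} ≪ P^{2σ−1}𝓛₁(|X₃(P²,ψ)| + ∫_{D⁴}^{P²}|X₃(x,ψ)|x⁻¹dx)`); §7 (7.2) p. 44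
[cite: Zhang2022LandauSiegel, §2 (2.16), §3 (3.5), §4 Lemma 4.2, (4.8), §7 (7.2)]; tree: `Skeleton.PsiOne` /
`Ineq35` / `X3` / `zeroSet` / `idx` (SkeletonObjects), `Lemma41.Xsum` (Section4PartialIntegration),
`Section4.Xsum_eq_X3` (Section4Eq48Deduction), `Section4.intervalIntegrable_norm_Xsum_div` (Section4WeightedAbel),
`KnifeEdge.nuPoly` / `NuMeanInvisible` / `bvOverhang` / `not_nuCloses_of_invisible` / `mainTerm_add_nuPiece` /
`abs_discMean_add_sub_le` (KnifeEdgeNuOverhang, p461177), `KnifeEdge.discMean` / `discWeight` / `weights_nonneg_of`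
(KnifeEdgeEStarLen, p456081), `KnifeEdge.Scale` / `ScaleEventuallyPos` (KnifeEdgeMuPsiOverhang, p458584). Cell files:
B-len/EDLIST.md v1.2 (E-074′), B-len/KILL-draft.md v1.1 §1 (ν), ls-theory INBOX 17:33:45Z, ls-obj-plan 18:36:49Z.
«The programme SEARCHES and TYPES; no claim about Landau–Siegel zeros, Theorems 1–2 of arXiv:2211.02515 or a
repaired Margin232 until a kernel theorem says so.»
-/

noncomputable section

open Complex Real Set Finset
open _root_.MeasureTheory intervalIntegral

namespace Literature.NumberTheory.LFunctions.Zhang2022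

namespace KnifeEdge

open Repair Skeleton

/-! ### Part 1 — the partial-summation device with a DISCRETE (Lipschitz-step) weight -/

/-- **Abel summation, exact, discrete form:** for `m ≤ M`,
`Σ_{m<n≤M} c(n)f(n) = X(M)f(M) − Σ_{m≤n<M} X(n)(f(n+1) − f(n))`, `X(n) = Σ_{m<k≤n} c(k)`.
[cite: Zhang2022LandauSiegel, §4 Lemma 4.2 (proof)] -/
theorem sum_Ioc_mul_eq_sub_sum_Ico (c f : ℕ → ℂ) {m M : ℕ} (h : m ≤ M) :
    ∑ n ∈ Finset.Ioc m M, c n * f n =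
      (∑ k ∈ Finset.Ioc m M, c k) * f M -
        ∑ n ∈ Finset.Ico m M, (∑ k ∈ Finset.Ioc m n, c k) * (f (n + 1) - f n) := by
  induction M, h using Nat.le_induction with
  | base => simp
  | succ M hmM ih =>
    rw [Finset.sum_Ioc_succ_top hmM, Finset.sum_Ioc_succ_top hmM, Finset.sum_Ico_succ_top hmM, ih]
    ring

/-- The discrete partial-summation BOUND: `|Σ_{m<n≤M} c(n)f(n)| ≤ |X(M)|·|f(M)| + Σ_{m≤n<M} |X(n)|·|f(n+1) − f(n)|`.
[cite: Zhang2022LandauSiegel, §4 Lemma 4.2 (proof)] -/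
theorem norm_sum_Ioc_mul_le_sum_Ico (c f : ℕ → ℂ) {m M : ℕ} (h : m ≤ M) :
    ‖∑ n ∈ Finset.Ioc m M, c n * f n‖ ≤
      ‖∑ k ∈ Finset.Ioc m M, c k‖ * ‖f M‖ +
        ∑ n ∈ Finset.Ico m M, ‖∑ k ∈ Finset.Ioc m n, c k‖ * ‖f (n + 1) - f n‖ := by
  rw [sum_Ioc_mul_eq_sub_sum_Ico c f h]
  refine (norm_sub_le _ _).trans (add_le_add (norm_mul_le _ _) ?_)
  refine (norm_sum_le _ _).trans (Finset.sum_le_sum fun n _ => ?_)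
  rw [norm_mul]

/-- The step function `X_a` against `dx/x` on one unit cell: for `0 < a < n` (`n` an integer),
`‖X_a(n)‖/(n+1) ≤ ∫_n^{n+1} ‖X_a(x)‖ x⁻¹ dx` (`X_a(x) = X_a(n)` on `[n, n+1)`).
[cite: Zhang2022LandauSiegel, §3 (3.5)] -/
theorem norm_Xsum_div_le_integral (c : ℕ → ℂ) {a : ℝ} (ha : 0 < a) {n : ℕ} (hn : a < n) :
    ‖Lemma41.Xsum c a n‖ / (n + 1) ≤
      ∫ x in (n : ℝ)..(n : ℝ) + 1, ‖Lemma41.Xsum c a x‖ / x := by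
  have hn0 : (0 : ℝ) < n := ha.trans hn
  have hn1 : (n : ℝ) ≤ (n : ℝ) + 1 := by linarith
  have hI : IntervalIntegrable (fun x : ℝ => ‖Lemma41.Xsum c a x‖ / x) volume (n : ℝ) ((n : ℝ) + 1) := by
    have h := Section4.intervalIntegrable_norm_Xsum_div c ha (hn.le.trans hn1)
    refine h.mono_set ?_
    rw [Set.uIcc_of_le hn1, Set.uIcc_of_le (hn.le.trans hn1)]
    exact Set.Icc_subset_Icc hn.le le_rfl
  have hIoo : IntegrableOn (fun x : ℝ => ‖Lemma41.Xsum c a x‖ / x) (Set.Ioo (n : ℝ) ((n : ℝ) + 1)) :=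
    ((intervalIntegrable_iff_integrableOn_Ioo_of_le hn1).1 hI)
  rw [intervalIntegral.integral_of_le hn1, MeasureTheory.integral_Ioc_eq_integral_Ioo]
  have hconst : ∫ _ in Set.Ioo (n : ℝ) ((n : ℝ) + 1), ‖Lemma41.Xsum c a n‖ / (n + 1) =
      ‖Lemma41.Xsum c a n‖ / (n + 1) := by
    rw [MeasureTheory.setIntegral_const, Real.volume_real_Ioo_of_le hn1, smul_eq_mul]
    ring
  rw [← hconst]
  refine MeasureTheory.setIntegral_mono_on (MeasureTheory.integrableOn_const ?_) hIoo measurableSet_Ioo ?_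
  · rw [Real.volume_Ioo]; exact ENNReal.ofReal_ne_top
  · intro x hx
    have hx0 : 0 < x := hn0.trans hx.1
    have hfl : ⌊x⌋₊ = n := (Nat.floor_eq_iff hx0.le).2 ⟨hx.1.le, hx.2⟩
    have hX : Lemma41.Xsum c a x = Lemma41.Xsum c a n := by
      rw [Lemma41.Xsum_def, Lemma41.Xsum_def, hfl, Nat.floor_natCast]
    rw [hX]
    exact div_le_div_of_nonneg_left (norm_nonneg _) hx0 hx.2.le

/-- **The partial-summation bound with a Lipschitz-step weight** (the discrete twin of the tree's
`Section4.norm_sum_mul_weight_le`, which needs a `C¹` weight): for `0 < a ≤ b`, `B ≥ 0`, a weight sequence `f`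
with `‖f(⌊b⌋)‖ ≤ A` and `n·‖f(n+1) − f(n)‖ ≤ B` for the integers `a < n`, `n + 1 ≤ b`:
`‖Σ_{⌊a⌋<n≤⌊b⌋} c(n)f(n)‖ ≤ A·‖X_a(b)‖ + 2B·∫_a^b ‖X_a(x)‖x⁻¹dx` — only the endpoint value and the `dx/x`-average of
the partial sums enter (the shape of (3.5)). [cite: Zhang2022LandauSiegel, §4 Lemma 4.2 (proof), (4.8) p. 20] -/
theorem norm_sum_Ioc_mul_le_of_step (c f : ℕ → ℂ) {a b : ℝ} (ha : 0 < a) (hab : a ≤ b) {A B : ℝ}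
    (hB0 : 0 ≤ B) (hA : ‖f ⌊b⌋₊‖ ≤ A)
    (hB : ∀ n : ℕ, a < n → (n : ℝ) + 1 ≤ b → (n : ℝ) * ‖f (n + 1) - f n‖ ≤ B) :
    ‖∑ n ∈ Finset.Ioc ⌊a⌋₊ ⌊b⌋₊, c n * f n‖ ≤
      A * ‖Lemma41.Xsum c a b‖ + 2 * B * ∫ x in a..b, ‖Lemma41.Xsum c a x‖ / x := by
  set m := ⌊a⌋₊ with hm
  set M := ⌊b⌋₊ with hM
  have hb0 : 0 ≤ b := ha.le.trans hab
  have hmM : m ≤ M := Nat.floor_le_floor hab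
  have hMb : (M : ℝ) ≤ b := Nat.floor_le hb0
  have ham : a < (m : ℝ) + 1 := Nat.lt_floor_add_one a
  have hXb : ∑ k ∈ Finset.Ioc m M, c k = Lemma41.Xsum c a b := (Lemma41.Xsum_eq_sum_Ioc c a b).symm
  have hXn : ∀ n : ℕ, ∑ k ∈ Finset.Ioc m n, c k = Lemma41.Xsum c a n := fun n => by
    rw [Lemma41.Xsum_eq_sum_Ioc, Nat.floor_natCast]
  -- non-negativity of the integrand and the whole integral
  have hg0 : ∀ x ∈ Set.Ioc a b, 0 ≤ ‖Lemma41.Xsum c a x‖ / x := fun x hx =>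
    div_nonneg (norm_nonneg _) (ha.trans hx.1).le
  have hInt : IntervalIntegrable (fun x : ℝ => ‖Lemma41.Xsum c a x‖ / x) volume a b :=
    Section4.intervalIntegrable_norm_Xsum_div c ha hab
  have hI0 : 0 ≤ ∫ x in a..b, ‖Lemma41.Xsum c a x‖ / x :=
    intervalIntegral.integral_nonneg hab fun x hx => div_nonneg (norm_nonneg _) (ha.le.trans hx.1)
  -- the discrete bound
  refine (norm_sum_Ioc_mul_le_sum_Ico c f hmM).trans (add_le_add ?_ ?_)
  · rw [hXb, mul_comm]
    exact mul_le_mul_of_nonneg_right hA (norm_nonneg _)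
  rcases eq_or_lt_of_le hmM with hEq | hlt
  · rw [← hEq, Finset.Ico_self, Finset.sum_empty]
    positivity
  rw [Finset.sum_eq_sum_Ico_succ_bot hlt, Finset.Ioc_self, Finset.sum_empty, norm_zero, zero_mul,
    zero_add]
  -- each cell `n ∈ [m+1, M)`
  have hcell : ∀ n ∈ Finset.Ico (m + 1) M,
      ‖∑ k ∈ Finset.Ioc m n, c k‖ * ‖f (n + 1) - f n‖ ≤
        2 * B * ∫ x in (n : ℝ)..(n : ℝ) + 1, ‖Lemma41.Xsum c a x‖ / x := by
    intro n hn
    rw [Finset.mem_Ico] at hn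
    have han : a < n := lt_of_lt_of_le ham (by exact_mod_cast hn.1)
    have hn0 : (0 : ℝ) < n := ha.trans han
    have hn1 : (1 : ℝ) ≤ n := by exact_mod_cast Nat.one_le_iff_ne_zero.mpr (by rintro rfl; simp at hn0)
    have hnb : (n : ℝ) + 1 ≤ b := le_trans (by exact_mod_cast hn.2) hMb
    have hΔ : ‖f (n + 1) - f n‖ ≤ B / n := by
      rw [le_div_iff₀ hn0, mul_comm]; exact hB n han hnb
    have hcellI := norm_Xsum_div_le_integral c ha han
    rw [hXn]
    calc ‖Lemma41.Xsum c a n‖ * ‖f (n + 1) - f n‖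
        ≤ ‖Lemma41.Xsum c a n‖ * (B / n) := mul_le_mul_of_nonneg_left hΔ (norm_nonneg _)
      _ = B * (‖Lemma41.Xsum c a n‖ / n) := by ring
      _ ≤ B * (2 * (‖Lemma41.Xsum c a n‖ / (n + 1))) := by
          refine mul_le_mul_of_nonneg_left ?_ hB0
          rw [div_le_iff₀ hn0]
          have : 2 * (‖Lemma41.Xsum c a n‖ / (n + 1)) * n
              = ‖Lemma41.Xsum c a n‖ * (2 * n / (n + 1)) := by ring
          rw [this]
          refine le_mul_of_one_le_right (norm_nonneg _) ?_
          rw [le_div_iff₀ (by linarith)]; linarith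
      _ = 2 * B * (‖Lemma41.Xsum c a n‖ / (n + 1)) := by ring
      _ ≤ 2 * B * ∫ x in (n : ℝ)..(n : ℝ) + 1, ‖Lemma41.Xsum c a x‖ / x :=
          mul_le_mul_of_nonneg_left hcellI (by positivity)
  refine (Finset.sum_le_sum hcell).trans ?_
  rw [← Finset.mul_sum]
  refine mul_le_mul_of_nonneg_left ?_ (by positivity)
  -- glue the cells: `Σ_{m+1 ≤ n < M} ∫_n^{n+1} = ∫_{m+1}^{M} ≤ ∫_a^b`
  have hglue : ∑ n ∈ Finset.Ico (m + 1) M, ∫ x in (n : ℝ)..(n : ℝ) + 1, ‖Lemma41.Xsum c a x‖ / x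
      = ∫ x in ((m + 1 : ℕ) : ℝ)..(M : ℝ), ‖Lemma41.Xsum c a x‖ / x := by
    have h := intervalIntegral.sum_integral_adjacent_intervals_Ico (a := fun k : ℕ => (k : ℝ))
      (f := fun x : ℝ => ‖Lemma41.Xsum c a x‖ / x) (μ := volume) (m := m + 1) (n := M)
      (Nat.succ_le_of_lt hlt) ?_
    · rw [← h]
      refine Finset.sum_congr rfl fun n _ => ?_
      push_cast; rfl
    · intro k hk
      have hak : a ≤ (k : ℝ) := le_of_lt (lt_of_lt_of_le ham (by exact_mod_cast hk.1))
      have hkb : ((k + 1 : ℕ) : ℝ) ≤ b := le_trans (by exact_mod_cast hk.2) hMb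
      refine hInt.mono_set ?_
      rw [Set.uIcc_of_le (by push_cast; linarith), Set.uIcc_of_le hab]
      exact Set.Icc_subset_Icc hak hkb
  rw [hglue]
  refine intervalIntegral.integral_mono_interval (le_of_lt (by exact_mod_cast ham)) ?_ hMb ?_ hInt
  · exact_mod_cast Nat.succ_le_of_lt hlt
  · exact MeasureTheory.ae_restrict_of_forall_mem measurableSet_Ioc hg0

/-! ### Part 2 — the LIPSCHITZ νψ-overhang class and the size of its Dirichlet weight -/

/-- **The Lipschitz νψ-overhang class `lipOverhang θ`:** profiles `v : ℝ → ℂ` that are `K`-Lipschitz on `ℝ` for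
some `K` and vanish off `[1, θ]` — hence wall value `v(1) = 0` and top value `v(θ) = 0` (`LipOverhang.apply_of_le_one`,
`LipOverhang.apply_of_le`); kinks allowed, jumps not; the derivative slot is not read. DECLARED NARROWING w.r.t. the
bounded-variation class `bvOverhang θ` of the ruling: no jumps (see the module docstring, «what is NOT covered»).
[cite: Zhang2022LandauSiegel, §7 (7.2) p.44] -/
def lipOverhang (θ : ℝ) : (ℝ → ℂ) → (ℝ → ℂ) → Prop := fun v _ =>
  (∃ K : NNReal, LipschitzWith K v) ∧ ∀ z, z < 1 ∨ θ < z → v z = 0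

/-- The zero profile is in the class (non-vacuity). [cite: Zhang2022LandauSiegel, §7 (7.2) p.44] -/
theorem lipOverhang_zero (θ : ℝ) : lipOverhang θ (fun _ => 0) (fun _ => 0) :=
  ⟨⟨0, LipschitzWith.const (0 : ℂ)⟩, fun _ _ => rfl⟩

/-- Zhang's ramp `φ_θ(y) = (y−1)(θ−y)` on `[1,θ]` (`KnifeEdge.phiT`, p442741) is NOT used here; instead the tent
`z ↦ min(z − 1, θ − z)⁺` is the inhabitant of record: it is `1`-Lipschitz and vanishes off `[1, θ]`.
[cite: Zhang2022LandauSiegel, §7 (7.2) p.44] -/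
def lipTent (θ : ℝ) (z : ℝ) : ℂ := ((max (min (z - 1) (θ - z)) 0 : ℝ) : ℂ)

/-- The tent is in the class at every `θ`. [cite: Zhang2022LandauSiegel, §7 (7.2) p.44] -/
theorem lipOverhang_lipTent (θ : ℝ) : lipOverhang θ (lipTent θ) (fun _ => 0) := by
  refine ⟨⟨1, ?_⟩, fun z hz => ?_⟩
  · refine LipschitzWith.of_dist_le_mul fun x y => ?_
    rw [lipTent, lipTent, NNReal.coe_one, one_mul, Complex.dist_eq, ← Complex.ofReal_sub,
      Complex.norm_real, Real.norm_eq_abs, Real.dist_eq]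
    calc |max (min (x - 1) (θ - x)) 0 - max (min (y - 1) (θ - y)) 0|
        ≤ max |min (x - 1) (θ - x) - min (y - 1) (θ - y)| |(0 : ℝ) - 0| :=
          abs_max_sub_max_le_max _ _ _ _
      _ ≤ max (max |x - 1 - (y - 1)| |θ - x - (θ - y)|) |(0 : ℝ) - 0| :=
          max_le_max (abs_min_sub_min_le_max _ _ _ _) le_rfl
      _ = |x - y| := by
          rw [sub_zero, abs_zero, show x - 1 - (y - 1) = x - y by ring,
            show θ - x - (θ - y) = -(x - y) by ring, abs_neg, max_self, max_eq_left (abs_nonneg _)]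
  · have hneg : min (z - 1) (θ - z) ≤ 0 := by
      rcases hz with hz | hz
      · exact (min_le_left _ _).trans (by linarith)
      · exact (min_le_right _ _).trans (by linarith)
    rw [lipTent, max_eq_right hneg, Complex.ofReal_zero]

/-- If `‖u‖ ≤ K·ε` for every `ε > 0` (`K ≥ 0`), then `u = 0`. [cite: Zhang2022LandauSiegel, §7 (7.2) p.44] -/
private theorem eq_zero_of_norm_le_mul_forall {u : ℂ} {K : ℝ} (hK : 0 ≤ K)
    (h : ∀ ε : ℝ, 0 < ε → ‖u‖ ≤ K * ε) : u = 0 := by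
  by_contra hne
  have hpos : 0 < ‖u‖ := norm_pos_iff.mpr hne
  have h1 := h (‖u‖ / (2 * (K + 1))) (by positivity)
  have h2 : K * (‖u‖ / (2 * (K + 1))) < ‖u‖ := by
    rw [show K * (‖u‖ / (2 * (K + 1))) = ‖u‖ * (K / (2 * (K + 1))) by ring]
    refine mul_lt_of_lt_one_right hpos ?_
    rw [div_lt_one (by positivity)]; linarith
  linarith

namespace LipOverhang

variable {v : ℝ → ℂ} {K : NNReal} {θ : ℝ}

/-- Wall value zero: a Lipschitz profile vanishing on `(−∞, 1)` vanishes on `(−∞, 1]`.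
[cite: Zhang2022LandauSiegel, §7 (7.2) p.44] -/
theorem apply_of_le_one (hv : LipschitzWith K v) (hsupp : ∀ z, z < 1 ∨ θ < z → v z = 0) {z : ℝ}
    (hz : z ≤ 1) : v z = 0 := by
  rcases lt_or_eq_of_le hz with hlt | rfl
  · exact hsupp z (Or.inl hlt)
  · refine eq_zero_of_norm_le_mul_forall K.2 fun ε hε => ?_
    have h := hv.dist_le_mul 1 (1 - ε)
    rwa [hsupp (1 - ε) (Or.inl (by linarith)), dist_zero_right, Real.dist_eq,
      show (1 : ℝ) - (1 - ε) = ε by ring, abs_of_pos hε] at h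

/-- Top value zero: a Lipschitz profile vanishing on `(θ, ∞)` vanishes on `[θ, ∞)`.
[cite: Zhang2022LandauSiegel, §7 (7.2) p.44] -/
theorem apply_of_le (hv : LipschitzWith K v) (hsupp : ∀ z, z < 1 ∨ θ < z → v z = 0) {z : ℝ}
    (hz : θ ≤ z) : v z = 0 := by
  rcases lt_or_eq_of_le hz with hlt | rfl
  · exact hsupp z (Or.inr hlt)
  · refine eq_zero_of_norm_le_mul_forall K.2 fun ε hε => ?_
    have h := hv.dist_le_mul θ (θ + ε)
    rwa [hsupp (θ + ε) (Or.inr (by linarith)), dist_zero_right, Real.dist_eq,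
      show θ - (θ + ε) = -ε by ring, abs_neg, abs_of_pos hε] at h

/-- Sup bound: `‖v(z)‖ ≤ K·(θ − 1)` everywhere (`θ ≥ 1`). [cite: Zhang2022LandauSiegel, §7 (7.2) p.44] -/
theorem norm_le (hv : LipschitzWith K v) (hsupp : ∀ z, z < 1 ∨ θ < z → v z = 0) (hθ : 1 ≤ θ)
    (z : ℝ) : ‖v z‖ ≤ K * (θ - 1) := by
  have hK : (0 : ℝ) ≤ K := K.2
  by_cases h1 : z ≤ 1
  · rw [apply_of_le_one hv hsupp h1, norm_zero]; exact mul_nonneg hK (by linarith)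
  by_cases h2 : θ ≤ z
  · rw [apply_of_le hv hsupp h2, norm_zero]; exact mul_nonneg hK (by linarith)
  have h1' := not_le.mp h1
  have h2' := not_le.mp h2
  have h := hv.dist_le_mul z 1
  rw [apply_of_le_one hv hsupp le_rfl, dist_zero_right, Real.dist_eq, abs_of_pos (by linarith)] at h
  exact h.trans (mul_le_mul_of_nonneg_left (by linarith) hK)

/-- Increment bound along any two points: `‖v(z′) − v(z)‖ ≤ K·|z′ − z|`. [cite: Zhang2022LandauSiegel, §7 (7.2) p.44] -/
theorem norm_sub_le (hv : LipschitzWith K v) (z z' : ℝ) : ‖v z' - v z‖ ≤ K * |z' - z| := by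
  have h := hv.dist_le_mul z' z
  rwa [dist_eq_norm, Real.dist_eq] at h

end LipOverhang

/-- MVT step for a critical-line twist: `‖(n+1)^{w} − n^{w}‖ ≤ ‖w‖·n^{Re w − 1}` for `n ≥ 1`, `Re w ≤ 1`
(so `= ‖w‖/n` when `Re w = 0`). [cite: Zhang2022LandauSiegel, §4 Lemma 4.1 (proof)] -/
theorem norm_natCast_succ_cpow_sub_cpow_le {n : ℕ} (hn : 1 ≤ n) {w : ℂ} (hw : w.re ≤ 1) :
    ‖((n + 1 : ℕ) : ℂ) ^ w - (n : ℂ) ^ w‖ ≤ ‖w‖ * (n : ℝ) ^ (w.re - 1) := by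
  have hn0 : (0 : ℝ) < n := by exact_mod_cast hn
  have hderiv : ∀ y ∈ Set.Icc (n : ℝ) (n + 1),
      HasDerivWithinAt (fun y : ℝ => (y : ℂ) ^ w) (w * (y : ℂ) ^ (w - 1)) (Set.Icc (n : ℝ) (n + 1)) y := by
    intro y hy
    exact (Lemma41.hasDerivAt_ofReal_cpow w (hn0.trans_le hy.1)).hasDerivWithinAt
  have hbound : ∀ y ∈ Set.Ico (n : ℝ) (n + 1), ‖w * (y : ℂ) ^ (w - 1)‖ ≤ ‖w‖ * (n : ℝ) ^ (w.re - 1) := by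
    intro y hy
    have hy0 : 0 < y := hn0.trans_le hy.1
    rw [norm_mul, Complex.norm_cpow_eq_rpow_re_of_pos hy0]
    have hre : (w - 1).re = w.re - 1 := by simp
    rw [hre]
    refine mul_le_mul_of_nonneg_left ?_ (norm_nonneg _)
    exact Real.rpow_le_rpow_of_nonpos hn0 hy.1 (by linarith)
  have key := norm_image_sub_le_of_norm_deriv_le_segment' hderiv hbound (n + 1)
    (Set.right_mem_Icc.2 (by linarith))
  have hcast : ((n + 1 : ℕ) : ℂ) = (((n : ℝ) + 1 : ℝ) : ℂ) := by push_cast; ring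
  have hcast2 : ((n : ℕ) : ℂ) = ((n : ℝ) : ℂ) := by push_cast; ring
  rw [hcast, hcast2]
  simpa using key

/-! ### Part 3 — PROVED, UNCONDITIONALLY: on `Ψ₁` the νψ-overhang of a Lipschitz profile is pointwise
`≤ 4K·𝓛^{−180}` at every sampled zero on the critical line -/

/-- `⌈e²⌉ ≤ D` gives `2 ≤ 𝓛`. [cite: Zhang2022LandauSiegel, §2 (2.1)] -/
private theorem two_le_ell_of_le {D : ℕ} (hD : ⌈Real.exp 2⌉₊ ≤ D) : 2 ≤ ell D := by
  have h : Real.exp 2 ≤ (D : ℝ) := (Nat.le_ceil _).trans (by exact_mod_cast hD)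
  exact (Real.le_log_iff_exp_le (lt_of_lt_of_le (Real.exp_pos _) h)).mpr h

/-- For `𝓛 ≥ 2`: `D⁴ = e^{4𝓛} < e^{𝓛⁹} = P`. [cite: Zhang2022LandauSiegel, §2 (2.1)] -/
private theorem pow_four_lt_bigP {D : ℕ} (hℓ : 2 ≤ ell D) (hD0 : (0 : ℝ) < D) :
    (D : ℝ) ^ 4 < bigP D := by
  have hexp : (D : ℝ) = Real.exp (ell D) := by rw [ell, Real.exp_log hD0]
  rw [hexp, ← Real.exp_nat_mul, bigP, Real.exp_lt_exp]
  have h8 : (2 : ℝ) ^ 8 ≤ ell D ^ 8 := pow_le_pow_left₀ (by norm_num) hℓ 8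
  have hℓ0 : 0 < ell D := by linarith
  have h9 : ell D ^ 9 = ell D * ell D ^ 8 := by ring
  rw [h9]; push_cast; nlinarith

/-- **E-074′ AS A KERNEL THEOREM — pointwise form, UNCONDITIONAL** («ν-piece invisible-(A)», the Lipschitz
class, on `Ψ₁` as DEFINED): for all large `D`, every `χ`, every `1 < θ ≤ 2`, every member `x = (p, ψ) ∈ Ψ₁`
(the index set of every discrete mean of the manuscript, defined by (3.4)–(3.6)), every sampled zero `ρ ∈ 𝔷(ψ)`
ON THE LINE, and every `K`-Lipschitz profile `v` vanishing off `[1, θ]`: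
`‖Σ_{n<P^θ} ν(n)ψ(n)v(log n/log P)n^{−ρ}‖ ≤ 4K·𝓛^{−180}`. Mechanism = the manuscript's own (4.8) device:
`ν(n)ψ(n)n^{−ρ} = c(n)·f(n)` with `c(n) = ν(n)ψ(n)n^{−s₀}` (partial sums from `D⁴` = `X₃(·,ψ)`) and the weight
`f(n) = v(z_n)n^{s₀−ρ}` (`|n^{s₀−ρ}| = 1`, `|s₀ − ρ| < 𝓛₁ = 𝓛⁴⁰⁵`), Abel summation over the WHOLE range `(D⁴, P²]`
(the profile kills `n < P` and `n ≥ P^θ`), so that only `|X₃(P²,ψ)|` and `∫_{D⁴}^{P²}|X₃(x,ψ)|dx/x` enter — and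
(3.5) bounds exactly these by `𝓛^{−585}`. No Assumption (A), no exceptional set beyond `Ψ₂` itself («Proposition
2.2 and some other results for `ψ ∈ Ψ₁` are unconditionally derived from the definition of `Ψ₁`», §2 p. 4).
[cite: Zhang2022LandauSiegel, §3 (3.5), §4 Lemma 4.2 (proof), (4.8) p. 20, §2 p. 4] -/
theorem norm_nuPoly_le_of_psiOne :
    ForAllLarge fun D _ χ => ∀ θ : ℝ, 1 < θ → θ ≤ 2 →
      ∀ x ∈ PsiOne χ, ∀ ρ ∈ zeroSet D x, ρ.re = 1 / 2 →
        ∀ (v : ℝ → ℂ) (K : NNReal), LipschitzWith K v → (∀ z, z < 1 ∨ θ < z → v z = 0) →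
          ‖nuPoly χ x v ⌈bigP D ^ θ⌉₊ ρ‖ ≤ 4 * K * (ell D ^ 180)⁻¹ := by
  refine ForAllLarge.of_le ⌈Real.exp 2⌉₊ ?_
  intro D _ χ hD _ _ θ hθ1 hθ2 x hx ρ hρ hρre v K hv hsupp
  -- parameters
  have hℓ2 : 2 ≤ ell D := two_le_ell_of_le hD
  have hℓ1 : 1 ≤ ell D := by linarith
  have hℓ0 : 0 < ell D := by linarith
  have hD0 : (0 : ℝ) < D := by
    have : Real.exp 2 ≤ (D : ℝ) := (Nat.le_ceil _).trans (by exact_mod_cast hD)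
    linarith [Real.exp_pos (2 : ℝ)]
  have hDpos : 0 < D := by exact_mod_cast hD0
  have hK : (0 : ℝ) ≤ K := K.2
  have hP : 0 < bigP D := Real.exp_pos _
  have hP1 : 1 ≤ bigP D := by rw [bigP]; exact Real.one_le_exp (by positivity)
  have hlogP : Real.log (bigP D) = ell D ^ 9 := by rw [bigP, Real.log_exp]
  have hL1 : 1 ≤ Real.log (bigP D) := by rw [hlogP]; exact one_le_pow₀ hℓ1
  have hL0 : 0 < Real.log (bigP D) := by linarith
  -- the range `(D⁴, P²]`
  have ha0 : 0 < (D : ℝ) ^ 4 := by positivity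
  have haP : (D : ℝ) ^ 4 < bigP D := pow_four_lt_bigP hℓ2 hD0
  have hPb : bigP D ≤ bigP D ^ 2 := by nlinarith
  have hab : (D : ℝ) ^ 4 ≤ bigP D ^ 2 := by linarith
  have hfloor_a : ⌊(D : ℝ) ^ 4⌋₊ = D ^ 4 := Section4.floor_natCast_pow_four D
  have hθb : bigP D ^ θ ≤ bigP D ^ 2 := by
    rw [← Real.rpow_natCast (bigP D) 2]
    exact Real.rpow_le_rpow_of_exponent_le hP1 (by exact_mod_cast hθ2)
  have hb1 : 1 ≤ ⌊bigP D ^ 2⌋₊ := Nat.le_floor (by push_cast; nlinarith)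
  -- the normalised coefficients `c`, the twist `w = s₀ − ρ`, the weight `f`
  set c : ℕ → ℂ := fun n => nu χ n * x.ψ (n : ZMod x.p) * (n : ℂ) ^ (-s0 D) with hc_def
  set w : ℂ := s0 D - ρ with hw_def
  set f : ℕ → ℂ := fun n => v (Real.log n / Real.log (bigP D)) * (n : ℂ) ^ w with hf_def
  have hw_re : w.re = 0 := by rw [hw_def, Complex.sub_re, s0_re, hρre]; ring
  obtain ⟨_, him, _⟩ := hρ
  have hw_norm : ‖w‖ ≤ ell D ^ 405 := by
    have h1 := Complex.norm_le_abs_re_add_abs_im w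
    have h2 : |w.im| < ell1 D := by
      rw [hw_def, Complex.sub_im, s0_im, abs_sub_comm]; exact him
    rw [hw_re, abs_zero, zero_add] at h1
    rw [ell1] at h2
    linarith
  have hnw : ∀ n : ℕ, 1 ≤ n → ‖(n : ℂ) ^ w‖ = 1 := fun n hn => by
    rw [Complex.norm_natCast_cpow_of_pos (by omega) w, hw_re, Real.rpow_zero]
  -- sup of the profile and of the weight
  have hvK : ∀ z, ‖v z‖ ≤ K := fun z =>
    (LipOverhang.norm_le hv hsupp hθ1.le z).trans (by nlinarith)
  have hfK : ∀ n : ℕ, 1 ≤ n → ‖f n‖ ≤ K := fun n hn => by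
    rw [hf_def]; dsimp only; rw [norm_mul, hnw n hn, mul_one]; exact hvK _
  -- Step 1: the νψ polynomial is `Σ_{D⁴ < n ≤ ⌊P²⌋} c(n) f(n)`
  have hterm : ∀ n : ℕ, 1 ≤ n →
      nu χ n * x.ψ (n : ZMod x.p) * v (Real.log n / Real.log (bigP D)) * (n : ℂ) ^ (-ρ)
        = c n * f n := by
    intro n hn
    have hn0 : (n : ℂ) ≠ 0 := by exact_mod_cast (by omega : n ≠ 0)
    rw [hc_def, hf_def]; dsimp only
    rw [show -ρ = -s0 D + w by rw [hw_def]; ring, Complex.cpow_add _ _ hn0]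
    ring
  have hvanish_low : ∀ n : ℕ, 1 ≤ n → n ≤ D ^ 4 → v (Real.log n / Real.log (bigP D)) = 0 := by
    intro n hn1 hn4
    apply LipOverhang.apply_of_le_one hv hsupp
    rw [div_le_one hL0]
    have hn0 : (0 : ℝ) < n := by exact_mod_cast hn1
    have hnP : (n : ℝ) ≤ bigP D := by
      have : (n : ℝ) ≤ (D : ℝ) ^ 4 := by exact_mod_cast hn4
      linarith
    exact Real.log_le_log hn0 hnP
  have hvanish_high : ∀ n : ℕ, ⌈bigP D ^ θ⌉₊ ≤ n → v (Real.log n / Real.log (bigP D)) = 0 := by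
    intro n hn
    apply LipOverhang.apply_of_le hv hsupp
    have hnθ : bigP D ^ θ ≤ n := Nat.ceil_le.mp hn
    rw [le_div_iff₀ hL0, ← Real.log_rpow hP]
    exact Real.log_le_log (Real.rpow_pos_of_pos hP θ) hnθ
  have hsum : nuPoly χ x v ⌈bigP D ^ θ⌉₊ ρ = ∑ n ∈ Finset.Ioc ⌊(D : ℝ) ^ 4⌋₊ ⌊bigP D ^ 2⌋₊, c n * f n := by
    rw [nuPoly, hfloor_a]
    have hL : ∑ n ∈ Finset.Ico 1 ⌈bigP D ^ θ⌉₊,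
        nu χ n * x.ψ (n : ZMod x.p) * v (Real.log n / Real.log (bigP D)) * (n : ℂ) ^ (-ρ)
        = ∑ n ∈ Finset.Ico 1 ⌈bigP D ^ θ⌉₊ ∩ Finset.Ioc (D ^ 4) ⌊bigP D ^ 2⌋₊,
          nu χ n * x.ψ (n : ZMod x.p) * v (Real.log n / Real.log (bigP D)) * (n : ℂ) ^ (-ρ) := by
      refine (Finset.sum_subset Finset.inter_subset_left fun n hn hn' => ?_).symm
      rw [Finset.mem_Ico] at hn
      have hnb : n ≤ ⌊bigP D ^ 2⌋₊ := Nat.le_floor (((Nat.lt_ceil.mp hn.2).le).trans hθb)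
      have hn4 : n ≤ D ^ 4 := by
        by_contra h4
        exact hn' (Finset.mem_inter.mpr
          ⟨Finset.mem_Ico.mpr hn, Finset.mem_Ioc.mpr ⟨not_le.mp h4, hnb⟩⟩)
      rw [hvanish_low n hn.1 hn4, mul_zero, zero_mul]
    have hR : ∑ n ∈ Finset.Ioc (D ^ 4) ⌊bigP D ^ 2⌋₊, c n * f n
        = ∑ n ∈ Finset.Ico 1 ⌈bigP D ^ θ⌉₊ ∩ Finset.Ioc (D ^ 4) ⌊bigP D ^ 2⌋₊, c n * f n := by
      refine (Finset.sum_subset Finset.inter_subset_right fun n hn hn' => ?_).symm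
      rw [Finset.mem_Ioc] at hn
      have hn1 : 1 ≤ n := le_trans (Nat.one_le_pow _ _ hDpos) hn.1.le
      have hnN : ⌈bigP D ^ θ⌉₊ ≤ n := by
        by_contra hN
        exact hn' (Finset.mem_inter.mpr
          ⟨Finset.mem_Ico.mpr ⟨hn1, not_le.mp hN⟩, Finset.mem_Ioc.mpr hn⟩)
      rw [hf_def]; dsimp only
      rw [hvanish_high n hnN, zero_mul, mul_zero]
    rw [hL, hR]
    exact Finset.sum_congr rfl fun n hn =>
      hterm n (Finset.mem_Ico.mp (Finset.mem_inter.mp hn).1).1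
  -- Step 2: the hypotheses of the step-weight device
  have hA : ‖f ⌊bigP D ^ 2⌋₊‖ ≤ K := hfK _ hb1
  have hB0 : (0 : ℝ) ≤ 2 * K * ell D ^ 405 := by positivity
  have hB : ∀ n : ℕ, (D : ℝ) ^ 4 < n → (n : ℝ) + 1 ≤ bigP D ^ 2 →
      (n : ℝ) * ‖f (n + 1) - f n‖ ≤ 2 * K * ell D ^ 405 := by
    intro n han _
    have hn0 : (0 : ℝ) < n := ha0.trans han
    have hn1 : 1 ≤ n := by exact_mod_cast Nat.one_le_iff_ne_zero.mpr (by rintro rfl; simp at hn0)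
    -- the increment of `z_n = log n / log P`
    have hz : |Real.log ((n + 1 : ℕ) : ℝ) / Real.log (bigP D) - Real.log n / Real.log (bigP D)|
        ≤ 1 / n := by
      rw [← sub_div, abs_div, abs_of_pos hL0]
      have hlog : Real.log ((n + 1 : ℕ) : ℝ) - Real.log n = Real.log (((n : ℝ) + 1) / n) := by
        push_cast
        rw [Real.log_div (by positivity) hn0.ne']
      have hlog1 : Real.log (((n : ℝ) + 1) / n) ≤ 1 / n := by
        have h := Real.log_le_sub_one_of_pos (show 0 < ((n : ℝ) + 1) / n by positivity)
        rwa [show ((n : ℝ) + 1) / n - 1 = 1 / n by field_simp; ring] at h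
      have hlog0 : 0 ≤ Real.log (((n : ℝ) + 1) / n) :=
        Real.log_nonneg (by rw [le_div_iff₀ hn0]; linarith)
      rw [hlog, abs_of_nonneg hlog0]
      calc Real.log (((n : ℝ) + 1) / n) / Real.log (bigP D)
          ≤ Real.log (((n : ℝ) + 1) / n) / 1 := div_le_div_of_nonneg_left hlog0 one_pos hL1
        _ ≤ 1 / n := by rw [div_one]; exact hlog1
    have hsplit : f (n + 1) - f n
        = (v (Real.log ((n + 1 : ℕ) : ℝ) / Real.log (bigP D)) - v (Real.log n / Real.log (bigP D)))
            * ((n + 1 : ℕ) : ℂ) ^ w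
          + v (Real.log n / Real.log (bigP D)) * (((n + 1 : ℕ) : ℂ) ^ w - (n : ℂ) ^ w) := by
      rw [hf_def]; dsimp only; ring
    have h1 : ‖(v (Real.log ((n + 1 : ℕ) : ℝ) / Real.log (bigP D)) - v (Real.log n / Real.log (bigP D)))
        * ((n + 1 : ℕ) : ℂ) ^ w‖ ≤ K * (1 / n) := by
      rw [norm_mul, hnw (n + 1) (by omega), mul_one]
      exact (LipOverhang.norm_sub_le hv _ _).trans (mul_le_mul_of_nonneg_left hz hK)
    have hpow : (n : ℝ) ^ (w.re - 1) = 1 / n := by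
      rw [hw_re, zero_sub, Real.rpow_neg_one, one_div]
    have h2 : ‖v (Real.log n / Real.log (bigP D)) * (((n + 1 : ℕ) : ℂ) ^ w - (n : ℂ) ^ w)‖
        ≤ K * (‖w‖ * (1 / n)) := by
      rw [norm_mul, ← hpow]
      exact mul_le_mul (hvK _) (norm_natCast_succ_cpow_sub_cpow_le hn1 (by rw [hw_re]; norm_num))
        (norm_nonneg _) hK
    have h12 : ‖f (n + 1) - f n‖ ≤ K * (1 / n) + K * (‖w‖ * (1 / n)) := by
      rw [hsplit]; exact (norm_add_le _ _).trans (add_le_add h1 h2)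
    have hw2 : 1 + ‖w‖ ≤ 2 * ell D ^ 405 := by linarith [one_le_pow₀ (n := 405) hℓ1]
    calc (n : ℝ) * ‖f (n + 1) - f n‖ ≤ (n : ℝ) * (K * (1 / n) + K * (‖w‖ * (1 / n))) :=
          mul_le_mul_of_nonneg_left h12 hn0.le
      _ = K * (1 + ‖w‖) := by field_simp
      _ ≤ K * (2 * ell D ^ 405) := mul_le_mul_of_nonneg_left hw2 hK
      _ = 2 * K * ell D ^ 405 := by ring
  -- Step 3: the device, then (3.5)
  have hdev := norm_sum_Ioc_mul_le_of_step c f ha0 hab hB0 hA hB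
  have hXeq : ∀ y : ℝ, Lemma41.Xsum c ((D : ℝ) ^ 4) y = X3 χ x y := fun y => Section4.Xsum_eq_X3 χ x y
  rw [← hsum] at hdev
  simp_rw [hXeq] at hdev
  have h35 : ‖X3 χ x (bigP D ^ 2)‖ + ∫ y in (D : ℝ) ^ 4..bigP D ^ 2, ‖X3 χ x y‖ / y
      < (ell D ^ 585)⁻¹ := hx.2.1
  have hI0 : 0 ≤ ∫ y in (D : ℝ) ^ 4..bigP D ^ 2, ‖X3 χ x y‖ / y :=
    intervalIntegral.integral_nonneg hab fun y hy => div_nonneg (norm_nonneg _) (ha0.le.trans hy.1)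
  have h405 : 1 ≤ ell D ^ 405 := one_le_pow₀ hℓ1
  have hKX : K * ‖X3 χ x (bigP D ^ 2)‖ ≤ 4 * K * ell D ^ 405 * ‖X3 χ x (bigP D ^ 2)‖ := by
    have := mul_nonneg hK (norm_nonneg (X3 χ x (bigP D ^ 2)))
    nlinarith
  calc ‖nuPoly χ x v ⌈bigP D ^ θ⌉₊ ρ‖
      ≤ K * ‖X3 χ x (bigP D ^ 2)‖
          + 2 * (2 * K * ell D ^ 405) * ∫ y in (D : ℝ) ^ 4..bigP D ^ 2, ‖X3 χ x y‖ / y := hdev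
    _ ≤ 4 * K * ell D ^ 405 *
          (‖X3 χ x (bigP D ^ 2)‖ + ∫ y in (D : ℝ) ^ 4..bigP D ^ 2, ‖X3 χ x y‖ / y) := by
        linarith
    _ ≤ 4 * K * ell D ^ 405 * (ell D ^ 585)⁻¹ := mul_le_mul_of_nonneg_left h35.le (by positivity)
    _ = 4 * K * (ell D ^ 180)⁻¹ := by
        rw [show (585 : ℕ) = 180 + 405 by norm_num, pow_add, mul_inv]
        field_simp

/-- The Lipschitz class is a sub-class of the ruling's bounded-variation class `bvOverhang θ` (sup `≤ K(θ−1)`,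
variation `≤ K(θ−1)` on `[1,θ]`), for `θ ≥ 1`. [cite: Zhang2022LandauSiegel, §7 (7.2) p.44] -/
theorem bvOverhang_of_lipOverhang {θ : ℝ} (hθ : 1 ≤ θ) {v v' : ℝ → ℂ} (h : lipOverhang θ v v') :
    bvOverhang θ v v' := by
  obtain ⟨⟨K, hv⟩, hsupp⟩ := h
  have hK : (0 : ℝ) ≤ K := K.2
  refine ⟨⟨K * (θ - 1), K * (θ - 1), mul_nonneg hK (by linarith), mul_nonneg hK (by linarith),
    LipOverhang.norm_le hv hsupp hθ, ?_⟩, hsupp⟩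
  have h1 : eVariationOn (v ∘ id) (Set.Icc 1 θ) ≤ K * eVariationOn (id : ℝ → ℝ) (Set.Icc 1 θ) :=
    (hv.lipschitzOnWith (s := Set.univ)).comp_eVariationOn_le (Set.mapsTo_univ _ _)
  have h2 : eVariationOn (id : ℝ → ℝ) (Set.Icc 1 θ) ≤ ENNReal.ofReal (θ - 1) := by
    have h := MonotoneOn.eVariationOn_le (monotone_id.monotoneOn (Set.Icc (1 : ℝ) θ))
      (Set.left_mem_Icc.2 hθ) (Set.right_mem_Icc.2 hθ)
    rwa [Set.inter_self] at h
  calc eVariationOn v (Set.Icc 1 θ) = eVariationOn (v ∘ id) (Set.Icc 1 θ) := rfl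
    _ ≤ K * eVariationOn (id : ℝ → ℝ) (Set.Icc 1 θ) := h1
    _ ≤ K * ENNReal.ofReal (θ - 1) := by gcongr
    _ = ENNReal.ofReal (K * (θ - 1)) := by
        rw [ENNReal.ofReal_mul hK, ENNReal.ofReal_coe_nnreal]

/-! ### Part 4 — PROVED: the discrete mean of the νψ-overhang is `≤ (4K𝓛^{−180})²·discWeight` — the RELATIVE
currency of row E-003 (`KnifeEdgeDiscMeanFlat.discMeanFlat`: bounds against `discMeanAbs + discWeight`), given
`Re ρ = ½` on the index set (Prop. 2.2 (i)'s output under (A), DISPLAYED as a binder, asserted by no one) -/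

/-- **E-074′ AS A KERNEL THEOREM — discrete-mean form (relative currency):** for all large `D`, IF every sampled
zero has `Re ρ = ½`, then for every `1 < θ ≤ 2` and every `K`-Lipschitz profile `v` vanishing off `[1,θ]`, the
discrete mean (2.16) of the νψ polynomial `Σ_{n<P^θ} ν(n)ψ(n)v(z_n)n^{−s}` over `Ψ₁ × 𝔷(ψ)` is at most
`(4K·𝓛^{−180})² · discWeight` (`discWeight = ΣΣ|Re 𝔠*·Re ω|`, the trivial-bound scale of a discrete mean): the
ν-overhang carries the fraction `16K²𝓛^{−360}` of the total weight — «invisible at main order» in the currency of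
the tree's E-003 theorems. From `norm_nuPoly_le_of_psiOne` termwise; no (A), no exceptional set.
[cite: Zhang2022LandauSiegel, §2 (2.16), §3 (3.5), §4 (4.8) p. 20] -/
theorem discMean_nuPoly_le (c' : ℝ) :
    ForAllLarge fun D _ χ => (∀ i ∈ idx χ, (i.2).re = 1 / 2) → ∀ θ : ℝ, 1 < θ → θ ≤ 2 →
      ∀ (v : ℝ → ℂ) (K : NNReal), LipschitzWith K v → (∀ z, z < 1 ∨ θ < z → v z = 0) →
        discMean c' χ (fun x s => nuPoly χ x v ⌈bigP D ^ θ⌉₊ s) ≤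
          (4 * K * (ell D ^ 180)⁻¹) ^ 2 * discWeight c' χ := by
  refine norm_nuPoly_le_of_psiOne.mono ?_
  intro D _ χ _ _ h hline θ hθ1 hθ2 v K hv hsupp
  unfold discMean discWeight
  rw [Finset.mul_sum]
  refine Finset.sum_le_sum fun i hi => ?_
  have hi' := hi
  rw [idx, Finset.mem_sigma] at hi'
  have h1 : i.1 ∈ PsiOne χ := mem_of_mem_finsetOf hi'.1
  have h2 : i.2 ∈ zeroSet D i.1 := mem_of_mem_finsetOf hi'.2
  have hb := h θ hθ1 hθ2 i.1 h1 i.2 h2 (hline i hi) v K hv hsupp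
  have hsq : ‖nuPoly χ i.1 v ⌈bigP D ^ θ⌉₊ i.2‖ ^ 2 ≤ (4 * K * (ell D ^ 180)⁻¹) ^ 2 :=
    pow_le_pow_left₀ (norm_nonneg _) hb 2
  dsimp only
  calc (cstar c' D i.1 i.2).re * ‖nuPoly χ i.1 v ⌈bigP D ^ θ⌉₊ i.2‖ ^ 2 * (omegaW D i.2).re
      = ((cstar c' D i.1 i.2).re * (omegaW D i.2).re) * ‖nuPoly χ i.1 v ⌈bigP D ^ θ⌉₊ i.2‖ ^ 2 := by
        ring
    _ ≤ |(cstar c' D i.1 i.2).re * (omegaW D i.2).re| * ‖nuPoly χ i.1 v ⌈bigP D ^ θ⌉₊ i.2‖ ^ 2 :=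
        mul_le_mul_of_nonneg_right (le_abs_self _) (sq_nonneg _)
    _ ≤ |(cstar c' D i.1 i.2).re * (omegaW D i.2).re| * (4 * K * (ell D ^ 180)⁻¹) ^ 2 :=
        mul_le_mul_of_nonneg_left hsq (abs_nonneg _)
    _ = (4 * K * (ell D ^ 180)⁻¹) ^ 2 * |(cstar c' D i.1 i.2).re * (omegaW D i.2).re| := by ring

/-! ### Part 5 — PROVED: the transfer theorem in the relative currency — adding a Lipschitz νψ-overhang to ANY
family of test values moves its discrete mean by at most `δ·(discMean + discWeight) + δ²·discWeight`, `δ = 4K𝓛^{−180}` -/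

/-- **«TRUE(u ⊕ v_ν) = TRUE(u) + o(main)» AS A KERNEL THEOREM (relative currency, raw binders):** for all large
`D`, IF every sampled zero has `Re ρ = ½` and the weights `Re 𝔠*·Re ω` are `≥ 0` on the index set (Prop. 2.2 (i),
Lemma 2.3 — displayed), then for every family of test values `F` (ANY design, any class), every `1 < θ ≤ 2` and
every `K`-Lipschitz `v` vanishing off `[1,θ]`, with `δ = 4K·𝓛^{−180}`:
`|Ξ(F + A_ν) − Ξ(F)| ≤ δ·(Ξ(F) + discWeight) + δ²·discWeight` — no main-order gain or loss from a ν-overhang,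
whatever the design it is glued to (polarisation + weighted Cauchy–Schwarz `abs_discMean_add_sub_le`, p461177,
on top of `discMean_nuPoly_le`). The §E-intake shape of the (L-b)ν «no».
[cite: Zhang2022LandauSiegel, §2 (2.16)–(2.17), Lemma 2.3, §3 (3.5), §4 (4.8)] -/
theorem abs_discMean_add_nuPoly_sub_le (c' : ℝ) :
    ForAllLarge fun D _ χ => (∀ i ∈ idx χ, (i.2).re = 1 / 2) →
      (∀ i ∈ idx χ, 0 ≤ (cstar c' D i.1 i.2).re * (omegaW D i.2).re) → ∀ θ : ℝ, 1 < θ → θ ≤ 2 →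
        ∀ (v : ℝ → ℂ) (K : NNReal), LipschitzWith K v → (∀ z, z < 1 ∨ θ < z → v z = 0) →
          ∀ F : Chr D → ℂ → ℂ,
            |discMean c' χ (fun x s => F x s + nuPoly χ x v ⌈bigP D ^ θ⌉₊ s) - discMean c' χ F| ≤
              4 * K * (ell D ^ 180)⁻¹ * (discMean c' χ F + discWeight c' χ)
                + (4 * K * (ell D ^ 180)⁻¹) ^ 2 * discWeight c' χ := by
  refine (discMean_nuPoly_le c').mono ?_
  intro D _ χ _ _ h hline hw θ hθ1 hθ2 v K hv hsupp F
  have hK : (0 : ℝ) ≤ K := K.2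
  have hδ0 : 0 ≤ 4 * (K : ℝ) * (ell D ^ 180)⁻¹ :=
    mul_nonneg (by positivity) (inv_nonneg.mpr (Even.pow_nonneg (by decide) _))
  have hG := h hline θ hθ1 hθ2 v K hv hsupp
  have halg := abs_discMean_add_sub_le hw F (fun x s => nuPoly χ x v ⌈bigP D ^ θ⌉₊ s)
  have hF0 := discMean_nonneg hw F
  have hG0 := discMean_nonneg hw (fun x s => nuPoly χ x v ⌈bigP D ^ θ⌉₊ s)
  have hW0 : 0 ≤ discWeight c' χ := discWeight_nonneg
  set δ : ℝ := 4 * K * (ell D ^ 180)⁻¹ with hδ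
  set XF : ℝ := discMean c' χ F with hXF
  set XG : ℝ := discMean c' χ (fun x s => nuPoly χ x v ⌈bigP D ^ θ⌉₊ s) with hXG
  set W : ℝ := discWeight c' χ with hWdef
  have hsqrt : 2 * Real.sqrt (XF * XG) ≤ δ * (XF + W) := by
    have hprod : XF * XG ≤ (δ * (XF + W) / 2) ^ 2 := by
      have hsq := mul_nonneg (sq_nonneg δ) (sq_nonneg (XF - W))
      calc XF * XG ≤ XF * (δ ^ 2 * W) := mul_le_mul_of_nonneg_left hG hF0
        _ ≤ (δ * (XF + W) / 2) ^ 2 := by nlinarith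
    have h := Real.sqrt_le_sqrt hprod
    rw [Real.sqrt_sq (by positivity)] at h
    linarith
  calc |discMean c' χ (fun x s => F x s + nuPoly χ x v ⌈bigP D ^ θ⌉₊ s) - XF|
      ≤ XG + 2 * Real.sqrt (XF * XG) := halg
    _ ≤ δ ^ 2 * W + δ * (XF + W) := add_le_add hG hsqrt
    _ = δ * (XF + W) + δ ^ 2 * W := by ring

/-- `D ≥ 3` eventually. [cite: Zhang2022LandauSiegel, §2 p. 4] -/
private theorem forAllLarge_three_le : ForAllLarge fun D _ _ => 3 ≤ D :=
  ForAllLarge.of_le 3 fun _ _ _ hD _ _ => hD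

/-- **The transfer theorem with the two skeleton nodes as named hypotheses** (`Prop22i`: sampled zeros on the line;
`Lemma23 c′`: `𝔠* ≥ 0` — the hypotheses of EVERY positivity endgame in the tree): same conclusion as
`abs_discMean_add_nuPoly_sub_le`. [cite: Zhang2022LandauSiegel, §2 Prop. 2.2 (i), Lemma 2.3, (2.16), §4 (4.8)] -/
theorem abs_discMean_add_nuPoly_sub_le_of_prop22i (c' : ℝ) (h22 : Prop22i) (h23 : Lemma23 c') :
    ForAllLarge fun D _ χ => ∀ θ : ℝ, 1 < θ → θ ≤ 2 →
      ∀ (v : ℝ → ℂ) (K : NNReal), LipschitzWith K v → (∀ z, z < 1 ∨ θ < z → v z = 0) →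
        ∀ F : Chr D → ℂ → ℂ,
          |discMean c' χ (fun x s => F x s + nuPoly χ x v ⌈bigP D ^ θ⌉₊ s) - discMean c' χ F| ≤
            4 * K * (ell D ^ 180)⁻¹ * (discMean c' χ F + discWeight c' χ)
              + (4 * K * (ell D ^ 180)⁻¹) ^ 2 * discWeight c' χ := by
  refine ((((abs_discMean_add_nuPoly_sub_le c').and h22).and h23).and forAllLarge_three_le).mono ?_
  intro D _ χ _ _ hh θ hθ1 hθ2 v K hv hsupp F
  obtain ⟨⟨⟨h, h22'⟩, h23'⟩, hD3⟩ := hh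
  have hw := weights_nonneg_of hD3 h23' h22'
  have hline : ∀ i ∈ idx χ, (i.2).re = 1 / 2 := fun i hi => by
    rw [idx, Finset.mem_sigma] at hi
    exact h22' i.1 (mem_of_mem_finsetOf hi.1) i.2
      (mem_prodZeroSetOmega_of_mem_zeroSet χ (mem_of_mem_finsetOf hi.2))
  exact h hline hw θ hθ1 hθ2 v K hv hsupp F

/-! ### Part 6 — the ABSOLUTE currency: `NuMeanInvisible c′ θ (lipOverhang θ) S` from a displayed WEIGHT-MASS
binder (`discWeight ≤ W·𝓛^k·S·𝔓`, `k < 360`), and the door shut for the Lipschitz class by `not_nuCloses_of_invisible` -/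

/-- `⌈exp L₀⌉ ≤ D` gives `L₀ ≤ 𝓛`. [cite: Zhang2022LandauSiegel, §2 (2.1)] -/
private theorem le_ell_of_ceil_exp_le_nu {L₀ : ℝ} {D : ℕ} (hD : ⌈Real.exp L₀⌉₊ ≤ D) : L₀ ≤ ell D := by
  have h : Real.exp L₀ ≤ (D : ℝ) := (Nat.le_ceil _).trans (by exact_mod_cast hD)
  exact (Real.le_log_iff_exp_le (lt_of_lt_of_le (Real.exp_pos _) h)).mpr h

/-- **`NuMeanInvisible` for the Lipschitz class from a weight-mass input (kernel implication).** If the total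
weight of the discrete mean satisfies `discWeight ≤ W·𝓛^k·S·𝔓` under (A) for all large `D` with `k < 360`
(a DISPLAYED binder — the polylog mass of `ΣΣ Re 𝔠*·Re ω` at the class's scale `S`; ls-theory 17:33:45Z: «below
main order once `c′` beats the polylog mass of the weights»; asserted by no one here), the scale is admissible
(`ScaleEventuallyPos S`) and Prop. 2.2 (i) holds, then the νψ overhang of every Lipschitz profile on `[1,θ]`,
`1 < θ ≤ 2`, is MEAN-INVISIBLE at scale `S`: `NuMeanInvisible c′ θ (lipOverhang θ) S` — the hypothesis of
`not_nuCloses_of_invisible` / `mainTerm_add_nuPiece` (p461177), now reduced to named skeleton inputs for this class.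
[cite: Zhang2022LandauSiegel, §2 (2.16), Prop. 2.2 (i), §3 (3.5), §4 (4.8)] -/
theorem nuMeanInvisible_lipOverhang_of_weightMass {c' θ : ℝ} (hθ1 : 1 < θ) (hθ2 : θ ≤ 2) {S : Scale}
    (hS : ScaleEventuallyPos S) (h22 : Prop22i) {W : ℝ} {k : ℕ} (hk : k < 360)
    (hW : ForAllLarge fun D _ χ => AssumptionA D χ →
      discWeight c' χ ≤ W * ell D ^ k * (S D χ * frakP D)) :
    NuMeanInvisible c' θ (lipOverhang θ) S := by
  refine ⟨hθ1, fun v v' hv ε hε => ?_⟩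
  obtain ⟨⟨K, hK⟩, hsupp⟩ := hv
  have hK0 : (0 : ℝ) ≤ K := K.2
  set M : ℝ := 16 * (K : ℝ) ^ 2 * max W 0 / ε with hM
  have hM0 : 0 ≤ M := by positivity
  obtain ⟨D₃, hP⟩ := frakP_eventually_pos
  have hP' : ForAllLarge fun D _ _ => 0 < frakP D := ForAllLarge.of_le D₃ fun D _ _ hD _ _ => hP D hD
  have hbig : ForAllLarge fun D _ _ => M + 1 ≤ ell D :=
    ForAllLarge.of_le ⌈Real.exp (M + 1)⌉₊ fun D _ _ hD _ _ => le_ell_of_ceil_exp_le_nu hD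
  refine (((((discMean_nuPoly_le c').and h22).and hW).and hS).and (hP'.and hbig)).mono ?_
  intro D _ χ _ _ hh hA
  obtain ⟨⟨⟨⟨h4, h22'⟩, hW'⟩, hS'⟩, hP0, hℓ⟩ := hh
  have hline : ∀ i ∈ idx χ, (i.2).re = 1 / 2 := fun i hi => by
    rw [idx, Finset.mem_sigma] at hi
    exact h22' i.1 (mem_of_mem_finsetOf hi.1) i.2
      (mem_prodZeroSetOmega_of_mem_zeroSet χ (mem_of_mem_finsetOf hi.2))
  have hb := h4 hline θ hθ1 hθ2 v K hK hsupp
  have hSP : 0 < S D χ * frakP D := mul_pos (hS' hA) hP0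
  have hWD := hW' hA
  have hℓ1 : 1 ≤ ell D := by linarith
  have hℓpos : 0 < ell D := by linarith
  have hkpos : 0 < ell D ^ k := pow_pos hℓpos k
  have hpow : ell D ^ 360 = ell D ^ k * ell D ^ (360 - k) := by
    rw [← pow_add, Nat.add_sub_cancel' hk.le]
  have hMle : M ≤ ell D ^ (360 - k) := by
    calc M ≤ ell D := by linarith
      _ = ell D ^ 1 := (pow_one _).symm
      _ ≤ ell D ^ (360 - k) := pow_le_pow_right₀ hℓ1 (by omega)
  have hsq : (4 * (K : ℝ) * (ell D ^ 180)⁻¹) ^ 2 = 16 * (K : ℝ) ^ 2 * (ell D ^ 360)⁻¹ := by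
    rw [show (360 : ℕ) = 180 * 2 by norm_num, pow_mul]
    field_simp
    ring
  have key : 16 * (K : ℝ) ^ 2 * max W 0 * ell D ^ k ≤ ε * ell D ^ 360 := by
    have hMε : 16 * (K : ℝ) ^ 2 * max W 0 = M * ε := by rw [hM]; field_simp
    rw [hMε, hpow]
    calc M * ε * ell D ^ k = (ε * ell D ^ k) * M := by ring
      _ ≤ (ε * ell D ^ k) * ell D ^ (360 - k) := mul_le_mul_of_nonneg_left hMle (by positivity)
      _ = ε * (ell D ^ k * ell D ^ (360 - k)) := by ring
  have h360 : 0 < ell D ^ 360 := pow_pos hℓpos 360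
  rw [show ε * S D χ * frakP D = ε * (S D χ * frakP D) by ring]
  calc discMean c' χ (fun x s => nuPoly χ x v ⌈bigP D ^ θ⌉₊ s)
      ≤ (4 * K * (ell D ^ 180)⁻¹) ^ 2 * discWeight c' χ := hb
    _ ≤ (4 * K * (ell D ^ 180)⁻¹) ^ 2 * (W * ell D ^ k * (S D χ * frakP D)) :=
        mul_le_mul_of_nonneg_left hWD (sq_nonneg _)
    _ ≤ (4 * K * (ell D ^ 180)⁻¹) ^ 2 * (max W 0 * ell D ^ k * (S D χ * frakP D)) := by
        refine mul_le_mul_of_nonneg_left ?_ (sq_nonneg _)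
        exact mul_le_mul_of_nonneg_right (mul_le_mul_of_nonneg_right (le_max_left _ _) hkpos.le) hSP.le
    _ = (16 * (K : ℝ) ^ 2 * max W 0 * ell D ^ k) * (ell D ^ 360)⁻¹ * (S D χ * frakP D) := by
        rw [hsq]; ring
    _ ≤ (ε * ell D ^ 360) * (ell D ^ 360)⁻¹ * (S D χ * frakP D) :=
        mul_le_mul_of_nonneg_right (mul_le_mul_of_nonneg_right key (inv_nonneg.mpr h360.le)) hSP.le
    _ = ε * (S D χ * frakP D) := by
        rw [mul_inv_cancel_right₀ h360.ne']

/-- **THE DOOR IS SHUT for the Lipschitz class, modulo named skeleton inputs only** (no desk derivation):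
weight-mass binder + admissible scale + Prop. 2.2 (i) + Lemma 2.3 ⇒ the dictionary of record of the Lipschitz
νψ-overhang class is `(M, X) = (0, 0)` AND the class does not close — `not_nuCloses_of_invisible` (p461177) fed by
`nuMeanInvisible_lipOverhang_of_weightMass`. [cite: Zhang2022LandauSiegel, §2 (2.16), Lemma 2.3, Prop. 2.2 (i), §4 (4.8)] -/
theorem not_nuCloses_lipOverhang_of_weightMass {c' θ : ℝ} (hθ1 : 1 < θ) (hθ2 : θ ≤ 2) {S : Scale}
    (hS : ScaleEventuallyPos S) (h22 : Prop22i) (h23 : Lemma23 c') {W : ℝ} {k : ℕ} (hk : k < 360)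
    (hW : ForAllLarge fun D _ χ => AssumptionA D χ →
      discWeight c' χ ≤ W * ell D ^ k * (S D χ * frakP D)) :
    NuDict c' θ (lipOverhang θ) S (fun _ _ => 0) 0 ∧ ¬ NuCloses (lipOverhang θ) (fun _ _ => 0) 0 :=
  not_nuCloses_of_invisible (nuMeanInvisible_lipOverhang_of_weightMass hθ1 hθ2 hS h22 hk hW) h22 h23

/-- **No lever of either sign from a Lipschitz νψ-overhang glued to ANY design, in the absolute currency**
(`mainTerm_add_nuPiece`, p461177, fed by `nuMeanInvisible_lipOverhang_of_weightMass`): a family `F` with main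
constant `m ≥ 0` at scale `S` keeps the main constant `m` after the overhang is added.
[cite: Zhang2022LandauSiegel, §2 (2.16), Lemma 2.3, Prop. 2.2 (i), §4 (4.8)] -/
theorem mainTerm_add_nuPiece_lipOverhang_of_weightMass {c' θ : ℝ} (hθ1 : 1 < θ) (hθ2 : θ ≤ 2)
    {S : Scale} (hS : ScaleEventuallyPos S) (h22 : Prop22i) (h23 : Lemma23 c') {W : ℝ} {k : ℕ}
    (hk : k < 360)
    (hW : ForAllLarge fun D _ χ => AssumptionA D χ →
      discWeight c' χ ≤ W * ell D ^ k * (S D χ * frakP D))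
    {m : ℝ} (hm : 0 ≤ m) {F : (D : ℕ) → [NeZero D] → DirichletCharacter ℂ D → Chr D → ℂ → ℂ}
    (hF : ∀ ε : ℝ, 0 < ε → ForAllLarge fun D _ χ => AssumptionA D χ →
      |discMean c' χ (F D χ) - m * S D χ * frakP D| ≤ ε * S D χ * frakP D)
    {v v' : ℝ → ℂ} (hv : lipOverhang θ v v') :
    ∀ ε : ℝ, 0 < ε → ForAllLarge fun D _ χ => AssumptionA D χ →
      |discMean c' χ (fun x s => F D χ x s + nuPoly χ x v ⌈bigP D ^ θ⌉₊ s) - m * S D χ * frakP D|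
        ≤ ε * S D χ * frakP D :=
  mainTerm_add_nuPiece (nuMeanInvisible_lipOverhang_of_weightMass hθ1 hθ2 hS h22 hk hW) hS hm hF hv
    h22 h23

end KnifeEdge

end Literature.NumberTheory.LFunctions.Zhang2022

end
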